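import Literature.MathematicalPhysics.QuantumFieldTheory.Balaban1983to89.DagDischargedII
import Literature.MathematicalPhysics.QuantumFieldTheory.Balaban1983to89.B11Prop7Assembly
import Literature.MathematicalPhysics.QuantumFieldTheory.Balaban1983to89.B11Thm1

/-!
# `Balaban1983to89.B11LeafKnitTower` — T. Bałaban, *The variational problem and background fields in renormalization group
# method for lattice gauge theories*, Commun. Math. Phys. **102** (1985) 277–309, doi:10.1007/bf01229381
# [Balaban1985Variational]: **the B11 leaf and the DAG node N07 over the SCALE TOWER of the induction on k** — the Sect. A law «every V
# with (7) admits a background U₀ with (14)» is NOT a hypothesis here but is DISCHARGED by the printed induction (p. 279 *"Theorem 1 will be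
# proved by induction with respect to k"*; Sect. A (11)–(14) p. 280), composing `B11Thm1.thm1At_allLevels` / `background_of_thm1At`
# (surge node pv12) with `B11Prop7Assembly.prop7From14_of_props_cap` (reader r08) BY NAME

statement-level bookkeeping over published theorems with citation tags; proofs = kernel composition of landed modules BY NAME; nothing here
is a claim about the Yang–Mills mass gap

PDF held: `paper:balaban1985-cmp102-variational-background` (journal page = PDF page + 276).

CITATION HEADER (lean-in-tree rule 2026-08-18) / WHAT IS REPRODUCED.  Cell `pub-ymgap`, Track A node N07 = [B11] (statement of record
`YMDAG.N07 w P := Dag.B11_main (DagBinding.leavesP w P)`, own leaf `b11 ↦ DagBinding.B11Leaf Z`), prover seat `pub-ymgap-dag-n07-a`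
(KNIT-BY-NAME), second module; sibling of `B11LeafKnit` (the knit over an arbitrary bundle `Z`, where the Sect. A law enters as a
hypothesis for small ε₁).  A NEW LEAF over `DagDischargedII`, `B11Prop7Assembly`, `B11Thm1`; nothing there is modified; NO definition is
introduced (theorems only; the B11 bundle of the tower is written as a structure literal of `DagBinding.PrintedCarriers11`).
THE OBJECTS.  `T : B11Thm1.Tower` = the scale tower of p. 279 / Sect. A (levels n ↔ k = n + 1, the variational problems `T.fam n i` on
pv12's carrier `B11Thm1.VarProblemA` = `B11.VarProblemX` + the second condition of (14), the maps datum ↦ datum, V ↦ V₀ (11), lift, and the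
k = 1 background); `famD p : B11.LGData` = the Sect. A–E (Landau gauge) description of the problem `p = ⟨n, i⟩`, bridged to it by
`β p : B11Prop7Assembly.Bridge` ((15) p. 280) and by `bg p` = «a configuration U₀ of the problem read as a background of its Sect. A–E
description», with the located law `hbg14` = (14) read on both carriers (pv12's `VarProblemA.Sat14 C₁ B₃ ε₁` ⇒ r08's
`LGData.Sat14 (C₁B₃ε₁) (C₁ε₁)`, DIVERGENCE D-pv12.2: the same printed sentence); C₁ = L³ (p. 280 *"The configuration U₀ constructed above
satisfies (14) with C₁ = L³"*).
§1 `prop7From14_tower`: Proposition 7 in its background-dependent form at EVERY level with ONE block of constants (pv12's leaf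
   `B11Thm1.Prop7From14 T B₃ L³`) from Props 2, 5, 6 on the Sect. A–E family over all levels — `B11Prop7Assembly.prop7From14_of_props_cap`
   applied once to the Σ-family (constants uniform in k because the inputs' constants are).
§2 `thm1At_tower_of_parts`, `thm1Printed_tower_of_parts`: Theorem 1 at every level / over all levels from Props 2, 5, 6, 8, Sect. F and the
   located leaves of Sect. A ((11) ⇒ (7) `StepA11`, (12) ⇒ (13) `StepA13`, k = 1 `BaseK1`) — `B11Thm1.thm1At_allLevels` BY NAME fed with §1.
§3 `background_tower_of_parts`, `prop7Printed_tower_of_parts`: the Sect. A law for ε₁ ≤ a₁ as a CONSEQUENCE (`B11Thm1.background_of_thm1At`)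
   and from it the printed background-free Proposition 7 over all levels with the constants a₀ ↦ min{a₀, B₃a₁}, a′₁ ↦ min{a′₁, a₁} (cell
   GAPS G-pv12-1: Proposition 7 is a node INSIDE the induction).
§4 `b11Leaf_tower_of_parts`: the B11 leaf of the TOWER BUNDLE `⟨Σ n, T.I n; T.famAll; famD; T.famAllX; famAn; B₀, B₁, B₃, B₅, L³, C₂, C₃, c₁,
   c₁′, c₄, δ₀, β₀⟩` from Props 2, 3, 4, 5, 6, 8, Sect. F, Prop 9 + located leaves ONLY; `b11_main_tower_of_parts`: the node
   `Dag.B11_main (leavesP w P)` at any run bound to that bundle.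
§5 `b11_main_of_stage_of`: the NODE-00 stage shape (cf. `Node00.b6_main_of_isWorldOfRecord₃_of`): a staged predicate pinning the B11 group to
   `Zrec θ` + `B11Leaf (Zrec θ)` at admissible θ ⇒ N07 at every such world and run.
HYPOTHESES THAT ARE NOT PRINTED STATEMENTS (dictionary / located readings, never asserted): `B11Thm1.VarProblemA.LawsA`,
`B11Prop7Assembly.Bridge.Laws`, `B11Prop7Assembly.ExistenceLeavesCap` ((112), (123)–(142) with the radius cap of p. 301), `hbg14`, and the
printed relations B₀ ≤ 4B₁ («we have B₁ = 5dLB₀» p. 296), B₃ ≥ 1 ((162)), L ≥ 1.  LOCATED CAVEAT carried by name: pv12's leaf `StepA11`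
((11) ⇒ (7) for the printed V₀) is REFUTED in the multi-domain case (cell GAPS G-B11-A1b; repaired architecture `B11Thm1TwoTier` with the
two-tier class (7″)) — a knit over `B11Thm1TwoTier.TowerT` is the same composition with `thm1At_allLevels_twoTier`; this module records
the printed architecture.  **Prop 9 `B11.Prop9Printed`: NO inhabitant in the tree** (GAPS G-B11-G2).
HONEST FRAMING: a count-neutral Track-A side landing (YM-PLAN §1); NOT a discharge of node N07 (the B11 group is FREE at NODE 00 Stages 1–3,
`Node00.IsWorldOfRecord₃`); one finite T⁴ programme at fixed ε; Bałaban AS PRINTED with page locators; nothing continuum / ℝ⁴ / OS /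
mass-gap / Clay.
-/

namespace Literature.MathematicalPhysics.QuantumFieldTheory.Balaban1983to89.B11LeafKnitTower

open Literature.MathematicalPhysics.QuantumFieldTheory.Balaban1983to89
open Literature.MathematicalPhysics.QuantumFieldTheory.Balaban1983to89.B11
open Literature.MathematicalPhysics.QuantumFieldTheory.Balaban1983to89.B11Thm1
open Literature.MathematicalPhysics.QuantumFieldTheory.Balaban1983to89.DagBinding
open Literature.MathematicalPhysics.QuantumFieldTheory.Balaban1983to89.B11Prop7Assembly (Bridge ExistenceLeavesCap)

variable (T : Tower) (famD : (Σ n, T.I n) → LGData) (β : ∀ p : Σ n, T.I n, Bridge (T.famAllX p) (famD p))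
  (bg : ∀ p : Σ n, T.I n, (T.fam p.1 p.2).Cfg → (famD p).Cfg)

/-! ## §1. Proposition 7 from a background, uniformly over the tower, from Props 2, 5, 6 -/

/-- **Proposition 7 in the background-dependent form at every level of the tower** (pv12's leaf `B11Thm1.Prop7From14 T B₃ L³`: for V with
(7) and U₀ with (14), «at most one critical orbit in (6)» for B₃ε₁ ≤ ε₀ ≤ a₀ and «a minimal orbit with ε₀ = O(1)C₁B₃ε₁» for ε₁ ≤ a′₁) from
Propositions 2, 5, 6 on the Sect. A–E family over ALL levels — `B11Prop7Assembly.prop7From14_of_props_cap` BY NAME (p. 296 (122), p. 299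
(141)–(142)), the background read on the Sect. A–E carrier through the located law `hbg14` (= (14) p. 280 on both carriers).
[cite: Balaban1985Variational, Prop. 7 p.299; (14) p.280; (122) p.296] -/
theorem prop7From14_tower {B₀ B₁ B₃ c₁ O₁ O₂ e₅ : ℝ}
    (hbg14 : ∀ (p : Σ n, T.I n) (ε₁ : ℝ) (V : (T.fam p.1 p.2).Bdry) (U : (T.fam p.1 p.2).Cfg),
      (T.fam p.1 p.2).Sat14 (T.L ^ 3) B₃ ε₁ V U → (famD p).Sat14 (T.L ^ 3 * B₃ * ε₁) (T.L ^ 3 * ε₁) ((β p).bdry V) (bg p U))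
    (laws : ∀ p, (β p).Laws (T.L ^ 3) B₃) (leaves : ∀ p, ExistenceLeavesCap (β p) B₀ B₃ (T.L ^ 3) O₁ O₂ e₅)
    (hB₀ : 0 < B₀) (hB₁ : 0 < B₁) (hB₃ : 1 ≤ B₃) (hL : 1 ≤ T.L) (hB₀B₁ : B₀ ≤ 4 * B₁) (hc₁ : 0 < c₁)
    (hO₁ : 0 < O₁) (hO₂ : 0 < O₂) (he₅ : 0 < e₅)
    (p2 : Prop2Printed B₁ B₃ (T.L ^ 3) c₁ famD) (p5 : Prop5Printed B₁ B₃ (T.L ^ 3) famD) (p6 : Prop6Printed B₀ B₃ (T.L ^ 3) famD) :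
    Prop7From14 T B₃ (T.L ^ 3) := by
  have hC₁ : (1 : ℝ) ≤ T.L ^ 3 := one_le_pow₀ hL
  obtain ⟨a₀, a₁', O, ha₀, ha₁', hO, H⟩ :=
    B11Prop7Assembly.prop7From14_of_props_cap β laws leaves hB₀ hB₁ hB₃ hC₁ hB₀B₁ hc₁ hO₁ hO₂ he₅ p2 p5 p6
  refine ⟨a₀, a₁', O, ha₀, ha₁', hO, fun n i ε₀ ε₁ hε₁ V hV U₀ h14 => ?_⟩
  exact H ⟨n, i⟩ ε₀ ε₁ hε₁ V hV (bg ⟨n, i⟩ U₀) (hbg14 ⟨n, i⟩ ε₁ V U₀ h14)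

/-! ## §2. Theorem 1 at every level from the parts and the Sect. A leaves -/

/-- **Theorem 1 at every level, one block of constants** (p. 279: *"Theorem 1 will be proved by induction with respect to k. … The first
step of the proof, for k = 1, will be covered by the proof of a general case"*): `B11Thm1.thm1At_allLevels` BY NAME, its input
`Prop7From14` supplied by `prop7From14_tower` — so from Props 2, 5, 6 (Sect. A–E family), Prop 8 and the Sect. F conclusion (over all
levels), the Sect. A leaves (11) ⇒ (7), (12) ⇒ (13), k = 1, and the dictionary. [cite: Balaban1985Variational, Thm 1 p.279; Sect. A pp.279–280] -/
theorem thm1At_tower_of_parts {B₀ B₁ B₃ c₁ O₁ O₂ e₅ : ℝ}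
    (hbg14 : ∀ (p : Σ n, T.I n) (ε₁ : ℝ) (V : (T.fam p.1 p.2).Bdry) (U : (T.fam p.1 p.2).Cfg),
      (T.fam p.1 p.2).Sat14 (T.L ^ 3) B₃ ε₁ V U → (famD p).Sat14 (T.L ^ 3 * B₃ * ε₁) (T.L ^ 3 * ε₁) ((β p).bdry V) (bg p U))
    (laws : ∀ p, (β p).Laws (T.L ^ 3) B₃) (leaves : ∀ p, ExistenceLeavesCap (β p) B₀ B₃ (T.L ^ 3) O₁ O₂ e₅)
    (lawsA : ∀ n i, (T.fam n i).LawsA) (hA11 : StepA11 T) (hA13 : StepA13 T B₃) (hK1 : BaseK1 T B₃)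
    (hB₀ : 0 < B₀) (hB₁ : 0 < B₁) (hB₃ : 1 ≤ B₃) (hL : 1 ≤ T.L) (hB₀B₁ : B₀ ≤ 4 * B₁) (hc₁ : 0 < c₁)
    (hO₁ : 0 < O₁) (hO₂ : 0 < O₂) (he₅ : 0 < e₅)
    (p2 : Prop2Printed B₁ B₃ (T.L ^ 3) c₁ famD) (p5 : Prop5Printed B₁ B₃ (T.L ^ 3) famD) (p6 : Prop6Printed B₀ B₃ (T.L ^ 3) famD)
    (p8 : Prop8Printed B₃ T.famAllX) (sF : SectFPrinted B₃ T.famAllX) :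
    ∃ C : B11Thm1.Consts, C.B₃ = B₃ ∧ ∀ (n : ℕ) (i : T.I n), Thm1At C (T.fam n i).toVarProblem :=
  thm1At_allLevels T B₃ (lt_of_lt_of_le one_pos hB₃) hL lawsA hA11 hA13 hK1
    (prop7From14_tower T famD β bg hbg14 laws leaves hB₀ hB₁ hB₃ hL hB₀B₁ hc₁ hO₁ hO₂ he₅ p2 p5 p6) p8 sF

/-- **Theorem 1 as printed over all levels of the tower** (`B11.Thm1Printed T.famAll`, constants uniform in k: *"The constants a₀, a₁, B₃
depend on d and L only"*) from the parts and the Sect. A leaves — `B11Thm1.thm1Printed_allLevels` BY NAME.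
[cite: Balaban1985Variational, Thm 1 p.279] -/
theorem thm1Printed_tower_of_parts {B₀ B₁ B₃ c₁ O₁ O₂ e₅ : ℝ}
    (hbg14 : ∀ (p : Σ n, T.I n) (ε₁ : ℝ) (V : (T.fam p.1 p.2).Bdry) (U : (T.fam p.1 p.2).Cfg),
      (T.fam p.1 p.2).Sat14 (T.L ^ 3) B₃ ε₁ V U → (famD p).Sat14 (T.L ^ 3 * B₃ * ε₁) (T.L ^ 3 * ε₁) ((β p).bdry V) (bg p U))
    (laws : ∀ p, (β p).Laws (T.L ^ 3) B₃) (leaves : ∀ p, ExistenceLeavesCap (β p) B₀ B₃ (T.L ^ 3) O₁ O₂ e₅)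
    (lawsA : ∀ n i, (T.fam n i).LawsA) (hA11 : StepA11 T) (hA13 : StepA13 T B₃) (hK1 : BaseK1 T B₃)
    (hB₀ : 0 < B₀) (hB₁ : 0 < B₁) (hB₃ : 1 ≤ B₃) (hL : 1 ≤ T.L) (hB₀B₁ : B₀ ≤ 4 * B₁) (hc₁ : 0 < c₁)
    (hO₁ : 0 < O₁) (hO₂ : 0 < O₂) (he₅ : 0 < e₅)
    (p2 : Prop2Printed B₁ B₃ (T.L ^ 3) c₁ famD) (p5 : Prop5Printed B₁ B₃ (T.L ^ 3) famD) (p6 : Prop6Printed B₀ B₃ (T.L ^ 3) famD)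
    (p8 : Prop8Printed B₃ T.famAllX) (sF : SectFPrinted B₃ T.famAllX) :
    Thm1Printed T.famAll :=
  thm1Printed_allLevels T B₃ (lt_of_lt_of_le one_pos hB₃) hL lawsA hA11 hA13 hK1
    (prop7From14_tower T famD β bg hbg14 laws leaves hB₀ hB₁ hB₃ hL hB₀B₁ hc₁ hO₁ hO₂ he₅ p2 p5 p6) p8 sF

/-! ## §3. The Sect. A law and the printed Proposition 7 as consequences of the induction -/

/-- **The Sect. A law as a CONSEQUENCE**: once Theorem 1 holds at every level (§2), every V with (7) and ε₁ ≤ a₁ admits a background U₀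
with (14), C₁ = L³ (p. 280 (11)–(13); k = 1: U₀ = V₀) — `B11Thm1.background_of_thm1At` BY NAME; the threshold is Theorem 1's own a₁.
[cite: Balaban1985Variational, (11)–(14) pp.279–280] -/
theorem background_tower_of_parts {B₀ B₁ B₃ c₁ O₁ O₂ e₅ : ℝ}
    (hbg14 : ∀ (p : Σ n, T.I n) (ε₁ : ℝ) (V : (T.fam p.1 p.2).Bdry) (U : (T.fam p.1 p.2).Cfg),
      (T.fam p.1 p.2).Sat14 (T.L ^ 3) B₃ ε₁ V U → (famD p).Sat14 (T.L ^ 3 * B₃ * ε₁) (T.L ^ 3 * ε₁) ((β p).bdry V) (bg p U))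
    (laws : ∀ p, (β p).Laws (T.L ^ 3) B₃) (leaves : ∀ p, ExistenceLeavesCap (β p) B₀ B₃ (T.L ^ 3) O₁ O₂ e₅)
    (lawsA : ∀ n i, (T.fam n i).LawsA) (hA11 : StepA11 T) (hA13 : StepA13 T B₃) (hK1 : BaseK1 T B₃)
    (hB₀ : 0 < B₀) (hB₁ : 0 < B₁) (hB₃ : 1 ≤ B₃) (hL : 1 ≤ T.L) (hB₀B₁ : B₀ ≤ 4 * B₁) (hc₁ : 0 < c₁)
    (hO₁ : 0 < O₁) (hO₂ : 0 < O₂) (he₅ : 0 < e₅)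
    (p2 : Prop2Printed B₁ B₃ (T.L ^ 3) c₁ famD) (p5 : Prop5Printed B₁ B₃ (T.L ^ 3) famD) (p6 : Prop6Printed B₀ B₃ (T.L ^ 3) famD)
    (p8 : Prop8Printed B₃ T.famAllX) (sF : SectFPrinted B₃ T.famAllX) :
    ∃ a : ℝ, 0 < a ∧ ∀ (n : ℕ) (i : T.I n) (ε₁ : ℝ), 0 < ε₁ → ε₁ ≤ a → ∀ V : (T.fam n i).Bdry, (T.fam n i).Reg7 ε₁ V →
      ∃ U₀ : (T.fam n i).Cfg, (T.fam n i).Sat14 (T.L ^ 3) B₃ ε₁ V U₀ := by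
  obtain ⟨C, hCB, H⟩ := thm1At_tower_of_parts T famD β bg hbg14 laws leaves lawsA hA11 hA13 hK1 hB₀ hB₁ hB₃ hL hB₀B₁ hc₁
    hO₁ hO₂ he₅ p2 p5 p6 p8 sF
  subst hCB
  exact ⟨C.a₁, C.a₁_pos, fun n i ε₁ hε₁ hε₁a V hV =>
    background_of_thm1At T C lawsA (lt_of_lt_of_le one_pos hL) hA11 hA13 hK1 H n i ε₁ hε₁ hε₁a V hV⟩

/-- **The printed (background-free) Proposition 7 over all levels as a CONSEQUENCE of the induction** — from `Prop7From14` (§1) and the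
Sect. A law for ε₁ ≤ a₁ (`background_tower_of_parts`), with the constants a₀ ↦ min{a₀, B₃a₁}, a′₁ ↦ min{a′₁, a₁}: clause (i) is invoked
only under B₃ε₁ ≤ ε₀ ≤ a₀ (so ε₁ ≤ a₁), clause (ii) only under ε₁ ≤ a′₁ (cell GAPS G-pv12-1: the printed Proposition 7 is a node inside the
induction, recovered once it has closed). [cite: Balaban1985Variational, Prop. 7 p.299; (11)–(14) pp.279–280] -/
theorem prop7Printed_tower_of_parts {B₀ B₁ B₃ c₁ O₁ O₂ e₅ : ℝ}
    (hbg14 : ∀ (p : Σ n, T.I n) (ε₁ : ℝ) (V : (T.fam p.1 p.2).Bdry) (U : (T.fam p.1 p.2).Cfg),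
      (T.fam p.1 p.2).Sat14 (T.L ^ 3) B₃ ε₁ V U → (famD p).Sat14 (T.L ^ 3 * B₃ * ε₁) (T.L ^ 3 * ε₁) ((β p).bdry V) (bg p U))
    (laws : ∀ p, (β p).Laws (T.L ^ 3) B₃) (leaves : ∀ p, ExistenceLeavesCap (β p) B₀ B₃ (T.L ^ 3) O₁ O₂ e₅)
    (lawsA : ∀ n i, (T.fam n i).LawsA) (hA11 : StepA11 T) (hA13 : StepA13 T B₃) (hK1 : BaseK1 T B₃)
    (hB₀ : 0 < B₀) (hB₁ : 0 < B₁) (hB₃ : 1 ≤ B₃) (hL : 1 ≤ T.L) (hB₀B₁ : B₀ ≤ 4 * B₁) (hc₁ : 0 < c₁)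
    (hO₁ : 0 < O₁) (hO₂ : 0 < O₂) (he₅ : 0 < e₅)
    (p2 : Prop2Printed B₁ B₃ (T.L ^ 3) c₁ famD) (p5 : Prop5Printed B₁ B₃ (T.L ^ 3) famD) (p6 : Prop6Printed B₀ B₃ (T.L ^ 3) famD)
    (p8 : Prop8Printed B₃ T.famAllX) (sF : SectFPrinted B₃ T.famAllX) :
    Prop7Printed B₃ (T.L ^ 3) T.famAllX := by
  obtain ⟨a₀, a₁', O, ha₀, ha₁', hO, H⟩ :=
    prop7From14_tower T famD β bg hbg14 laws leaves hB₀ hB₁ hB₃ hL hB₀B₁ hc₁ hO₁ hO₂ he₅ p2 p5 p6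
  obtain ⟨a, ha, Hbg⟩ := background_tower_of_parts T famD β bg hbg14 laws leaves lawsA hA11 hA13 hK1 hB₀ hB₁ hB₃ hL hB₀B₁ hc₁
    hO₁ hO₂ he₅ p2 p5 p6 p8 sF
  have hB₃pos : 0 < B₃ := lt_of_lt_of_le one_pos hB₃
  refine ⟨min a₀ (B₃ * a), min a₁' a, O, lt_min ha₀ (mul_pos hB₃pos ha), lt_min ha₁' ha, hO, fun p ε₀ ε₁ hε₁ V hV => ⟨?_, ?_⟩⟩
  · intro hε₀ hB₃ε
    have hε₁a : ε₁ ≤ a := by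
      have h : B₃ * ε₁ ≤ B₃ * a := hB₃ε.trans (hε₀.trans (min_le_right _ _))
      exact le_of_mul_le_mul_left h hB₃pos
    obtain ⟨U₀, h14⟩ := Hbg p.1 p.2 ε₁ hε₁ hε₁a V hV
    exact (H p.1 p.2 ε₀ ε₁ hε₁ V hV U₀ h14).1 (hε₀.trans (min_le_left _ _)) hB₃ε
  · intro hε₁a
    obtain ⟨U₀, h14⟩ := Hbg p.1 p.2 ε₁ hε₁ (hε₁a.trans (min_le_right _ _)) V hV
    exact (H p.1 p.2 ε₀ ε₁ hε₁ V hV U₀ h14).2 (hε₁a.trans (min_le_left _ _))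

/-! ## §4. The B11 leaf of the tower bundle and the node N07 at a run bound to it -/

/-- **THE B11 LEAF OF THE TOWER BUNDLE FROM PRINTED PARTS AND LOCATED LEAVES ONLY.**  For the bundle whose index set is all levels and
data `Σ n, T.I n`, whose Theorem-1 family is `T.famAll`, whose Props-7/8/Sect.-F family is `T.famAllX`, whose Sect. A–E family is `famD`
(bridged by `β`, `bg`), with an arbitrary Prop-9 family `famAn` and constants (B₀, B₁, B₃, B₅, C₁ = L³, C₂, C₃, c₁, c₁′, c₄, δ₀, β₀): the ten
conjuncts of `DagBinding.B11Leaf` follow from Props 2, 3, 4, 5, 6, 8, Sect. F, Prop 9 (the module `…B11`'s typed statements) and the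
located leaves — Theorem 1 by the induction on k (§2), Proposition 7 as its by-product (§3).  Nothing of the series is asserted.
[cite: Balaban1985Variational, Thm 1 p.279, Props 2–9 pp.281–309; Sect. A pp.279–280] -/
theorem b11Leaf_tower_of_parts (famAn : (Σ n, T.I n) → AnData) {B₀ B₁ B₃ B₅ C₂ C₃ c₁ c1h c₄ δ₀ β₀ O₁ O₂ e₅ : ℝ}
    (hbg14 : ∀ (p : Σ n, T.I n) (ε₁ : ℝ) (V : (T.fam p.1 p.2).Bdry) (U : (T.fam p.1 p.2).Cfg),
      (T.fam p.1 p.2).Sat14 (T.L ^ 3) B₃ ε₁ V U → (famD p).Sat14 (T.L ^ 3 * B₃ * ε₁) (T.L ^ 3 * ε₁) ((β p).bdry V) (bg p U))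
    (laws : ∀ p, (β p).Laws (T.L ^ 3) B₃) (leaves : ∀ p, ExistenceLeavesCap (β p) B₀ B₃ (T.L ^ 3) O₁ O₂ e₅)
    (lawsA : ∀ n i, (T.fam n i).LawsA) (hA11 : StepA11 T) (hA13 : StepA13 T B₃) (hK1 : BaseK1 T B₃)
    (hB₀ : 0 < B₀) (hB₁ : 0 < B₁) (hB₃ : 1 ≤ B₃) (hL : 1 ≤ T.L) (hB₀B₁ : B₀ ≤ 4 * B₁) (hc₁ : 0 < c₁)
    (hO₁ : 0 < O₁) (hO₂ : 0 < O₂) (he₅ : 0 < e₅)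
    (p2 : Prop2Printed B₁ B₃ (T.L ^ 3) c₁ famD) (p3 : Prop3Printed (T.L ^ 3) B₃ C₂ C₃ B₀ c1h c₄ δ₀ famD)
    (p4 : Prop4Printed (T.L ^ 3) B₃ famD) (p5 : Prop5Printed B₁ B₃ (T.L ^ 3) famD) (p6 : Prop6Printed B₀ B₃ (T.L ^ 3) famD)
    (p8 : Prop8Printed B₃ T.famAllX) (sF : SectFPrinted B₃ T.famAllX) (p9 : Prop9Printed B₅ (T.L ^ 3) β₀ δ₀ famAn) :
    B11Leaf
      { I11 := (Σ n, T.I n), famV := T.famAll, famLG := famD, famX := T.famAllX, famAn := famAn, B₀ := B₀, B₁ := B₁, B₃ := B₃,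
        B₅ := B₅, C₁ := T.L ^ 3, C₂ := C₂, C₃ := C₃, c₁ := c₁, c1h := c1h, c₄ := c₄, δ₀ := δ₀, β₀ := β₀ } where
  t1 := thm1Printed_tower_of_parts T famD β bg hbg14 laws leaves lawsA hA11 hA13 hK1 hB₀ hB₁ hB₃ hL hB₀B₁ hc₁ hO₁ hO₂ he₅
    p2 p5 p6 p8 sF
  p2 := p2
  p3 := p3
  p4 := p4
  p5 := p5
  p6 := p6
  p7 := prop7Printed_tower_of_parts T famD β bg hbg14 laws leaves lawsA hA11 hA13 hK1 hB₀ hB₁ hB₃ hL hB₀B₁ hc₁ hO₁ hO₂ he₅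
    p2 p5 p6 p8 sF
  p8 := p8
  sF := sF
  p9 := p9

/-- **THE NODE N07 AT A RUN BOUND TO THE TOWER BUNDLE**: for every binding world and run with `w.up P = Upstream.ofPrintedAllXPN X Y Z V W`
whose B11 group `Z` IS the tower bundle of `b11Leaf_tower_of_parts`, its inputs give `Dag.B11_main (leavesP w P)` («b5 → b6 → b7 → b8 → b9
→ b11»; the antecedents are not consumed — see `B11LeafKnit` §3 for the b8 edge).  The hypothesis list is what a NODE-00 pin of the B11
group by a scale tower must carry for N07; nothing is discharged here (the group is free at Stages 1–3).
[cite: Balaban1985Variational, Thm 1 p.279, Props 2–9 pp.281–309] -/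
theorem b11_main_tower_of_parts (w : WorldP) (P : B12.RunParams) (X : PrintedCarriersR) (Y : PrintedCarriers9X)
    (V : PrintedCarriers14R) (W : PrintedCarriers15) (famAn : (Σ n, T.I n) → AnData)
    {B₀ B₁ B₃ B₅ C₂ C₃ c₁ c1h c₄ δ₀ β₀ O₁ O₂ e₅ : ℝ}
    (hP : w.up P = Upstream.ofPrintedAllXPN X Y
      { I11 := (Σ n, T.I n), famV := T.famAll, famLG := famD, famX := T.famAllX, famAn := famAn, B₀ := B₀, B₁ := B₁, B₃ := B₃,
        B₅ := B₅, C₁ := T.L ^ 3, C₂ := C₂, C₃ := C₃, c₁ := c₁, c1h := c1h, c₄ := c₄, δ₀ := δ₀, β₀ := β₀ } V W)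
    (hbg14 : ∀ (p : Σ n, T.I n) (ε₁ : ℝ) (V : (T.fam p.1 p.2).Bdry) (U : (T.fam p.1 p.2).Cfg),
      (T.fam p.1 p.2).Sat14 (T.L ^ 3) B₃ ε₁ V U → (famD p).Sat14 (T.L ^ 3 * B₃ * ε₁) (T.L ^ 3 * ε₁) ((β p).bdry V) (bg p U))
    (laws : ∀ p, (β p).Laws (T.L ^ 3) B₃) (leaves : ∀ p, ExistenceLeavesCap (β p) B₀ B₃ (T.L ^ 3) O₁ O₂ e₅)
    (lawsA : ∀ n i, (T.fam n i).LawsA) (hA11 : StepA11 T) (hA13 : StepA13 T B₃) (hK1 : BaseK1 T B₃)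
    (hB₀ : 0 < B₀) (hB₁ : 0 < B₁) (hB₃ : 1 ≤ B₃) (hL : 1 ≤ T.L) (hB₀B₁ : B₀ ≤ 4 * B₁) (hc₁ : 0 < c₁)
    (hO₁ : 0 < O₁) (hO₂ : 0 < O₂) (he₅ : 0 < e₅)
    (p2 : Prop2Printed B₁ B₃ (T.L ^ 3) c₁ famD) (p3 : Prop3Printed (T.L ^ 3) B₃ C₂ C₃ B₀ c1h c₄ δ₀ famD)
    (p4 : Prop4Printed (T.L ^ 3) B₃ famD) (p5 : Prop5Printed B₁ B₃ (T.L ^ 3) famD) (p6 : Prop6Printed B₀ B₃ (T.L ^ 3) famD)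
    (p8 : Prop8Printed B₃ T.famAllX) (sF : SectFPrinted B₃ T.famAllX) (p9 : Prop9Printed B₅ (T.L ^ 3) β₀ δ₀ famAn) :
    Dag.B11_main (leavesP w P) := by
  show (w.up P).b5 → (w.up P).b6 → (w.up P).b7 → (w.up P).b8 → (w.up P).b9 → (w.up P).b11
  rw [hP]
  exact fun _ _ _ _ _ => b11Leaf_tower_of_parts T famD β bg famAn hbg14 laws leaves lawsA hA11 hA13 hK1 hB₀ hB₁ hB₃ hL hB₀B₁
    hc₁ hO₁ hO₂ he₅ p2 p3 p4 p5 p6 p8 sF p9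

/-! ## §5. The NODE-00 stage shape (for the seat that pins the B11 group) -/

/-- **N07 at every world of a stage that pins the B11 group, MODULO THE GROUP'S LEAF** — the shape of
`Node00.b6_main_of_isWorldOfRecord₃_of` for N03: a staged world-of-record predicate «for some admissible parameter `θ`, at every run the
upstream block is the N-binding over the stage's bundles, the B11 group being `Zrec θ`» (the other bundles free or pinned, run-indexed or
not — abstracted as `car θ X`, `Y`, `V`, `W`), together with `hleaf : B11Leaf (Zrec θ)` at admissible `θ` (what `b11Leaf_tower_of_parts`
delivers for a tower bundle), gives `Dag.B11_main (leavesP w P)` at every such world and run.  Pure bookkeeping; the definition of the B11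
group of record is NODE 00's. [cite: Balaban1985Variational, Thm 1 p.279, Props 2–9 pp.281–309 (bookkeeping)] -/
theorem b11_main_of_stage_of {Θ : Type} (Adm : Θ → Prop) (car : Θ → PrintedCarriersR → PrintedCarriersR)
    (Zrec : Θ → PrintedCarriers11) (hleaf : ∀ θ, Adm θ → B11Leaf (Zrec θ)) (w : WorldP)
    (hw : ∃ θ, Adm θ ∧ ∀ P : B12.RunParams, ∃ (X : PrintedCarriersR) (Y : PrintedCarriers9X) (V : PrintedCarriers14R)
      (W : PrintedCarriers15), w.up P = Upstream.ofPrintedAllXPN (car θ X) Y (Zrec θ) V W)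
    (P : B12.RunParams) : Dag.B11_main (leavesP w P) := by
  obtain ⟨θ, hθ, hup⟩ := hw
  obtain ⟨X, Y, V, W, hP⟩ := hup P
  show (w.up P).b5 → (w.up P).b6 → (w.up P).b7 → (w.up P).b8 → (w.up P).b9 → (w.up P).b11
  rw [hP]
  exact fun _ _ _ _ _ => hleaf θ hθ

end Literature.MathematicalPhysics.QuantumFieldTheory.Balaban1983to89.B11LeafKnitTower
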